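import Mathlib.LinearAlgebra.Matrix.Transvection
import Mathlib.LinearAlgebra.Matrix.GeneralLinearGroup.Defs
import Mathlib.LinearAlgebra.Matrix.Permutation
import Mathlib.Analysis.SpecialFunctions.Pow.Real
import HarnessLib

/-!
# Over an ordered field the squares generate `GL_n⁺`: `⟨g²⟩ = {det > 0}`, index two, one sign representative

Layer `Literature/LinearAlgebra/Matrix`, namespace `Literature.LinearAlgebra.Matrix` (sub-namespace `GeneralLinearGroup`).
THEOREMS ONLY (no definition, no named fact).  Companion of `GeneralLinearGroupSquares` (square-closed fields, e.g. `ℂ`: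
the squares generate ALL of `GL_n`); here `𝕜` is LINEARLY ORDERED with square roots of non-negative elements (e.g. `ℝ`),
where `g ↦ sign (det g)` has order two and the squares generate exactly its kernel.

Source. E. Artin, *Geometric Algebra*, Chap. IV **Thm. 4.6** (transvections generate `SL_n(k)`; Mathlib's form
`Matrix.diagonal_transvection_induction_of_det_ne_zero`) and **Thm. 4.7** (`GL_n(k)/SL_n(k) ≅ k^*` by `det`, so
`GL_n(k)/⟨squares⟩` is a quotient of `k^*/(k^*)²`, `= {±1}` for an ordered square-rooted `k`).  Proved here from Thm. 4.6:

* §1 (any group `G`, `S = ⟨g²⟩`): `S` is normal (`conj_mem_closure_isSquare`); every COMMUTATOR is a product of three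
  squares, `[a,b] = (ab)² (b⁻¹a⁻¹b)² (b⁻¹)²` (`commutator_mem_closure_isSquare`); **`eq_of_sq_eq_of_prod_squares_mul_rep`** —
  two multiplicative scalars `c, τ` on a multiplicatively closed `S₀ ∋ 1` with `c² = τ²`, `τ ≠ 0`, agree on `S₀` as soon
  as they agree on REPRESENTATIVES `R ⊆ S₀` with `S₀ ⊆ (products of squares of elements of S₀) · R` — the form in which
  "equal squares ⇒ equal" survives on a group NOT generated by squares (e.g. a real parabolic `P_{n,n}(ℝ)`).
* §2 (`𝕜` ordered): `closure_isSquare_le_GLPos`; with `∀ x ≥ 0, IsSquare x`: **`mem_closure_isSquare_of_det_pos`**,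
  **`closure_isSquare_eq_GLPos`** (`⟨g²⟩ = GL_n⁺(𝕜)`: transvections `t(c) = t(c/2)²` and positive diagonal matrices are
  squares; two sign flips form the commutator `ε_i ε_j = [P_{(ij)}, ε_j]`); index `≤ 2` with ANY negative-determinant
  element as representative (`mul_inv_mem_closure_isSquare_of_det_neg`, `exists_mem_closure_isSquare_mul_eq`); two
  homomorphisms `GL_n(𝕜) →* A` (`A` commutative) with equal squares agreeing at ONE element of negative determinant are
  equal (`monoidHom_eq_of_sq_eq_sq_of_apply_eq`).
* §3 the instances over `ℝ` (`…_real`).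

Use: the archimedean places of type (ii) (a real place of `F` split in `E`, `H(F_v) ≅ GL_{2n}(ℝ)`, Siegel parabolic not
square-generated) of the general-`E/F` kernel construction of [GelbartRogawski1991, Prop. 3.1.1]; nothing here depends on it.

## References

* [Artin1988] E. Artin, *Geometric Algebra*, Interscience (1957); Wiley Classics reprint (1988), Chap. IV, Thm. 4.6, 4.7.
-/

set_option autoImplicit false

open Matrix

namespace Literature.LinearAlgebra.Matrix

/-! ## §1. Groups and their subgroup generated by squares: normality, commutators, representatives -/

section Abstract

variable {G : Type*} [Group G]

/-- **`⟨g²⟩` is normal**: `g x g⁻¹ ∈ ⟨squares⟩` for `x ∈ ⟨squares⟩` (a conjugate of a square is a square).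
[cite: Artin1988, Chap. IV Thm. 4.7] -/
theorem conj_mem_closure_isSquare (g : G) {x : G} (hx : x ∈ Subgroup.closure {y : G | IsSquare y}) :
    g * x * g⁻¹ ∈ Subgroup.closure {y : G | IsSquare y} := by
  induction hx using Subgroup.closure_induction with
  | mem y hy =>
    obtain ⟨r, rfl⟩ := hy
    refine Subgroup.subset_closure ⟨g * r * g⁻¹, ?_⟩
    group
  | one =>
    rw [mul_one, mul_inv_cancel]
    exact Subgroup.one_mem _
  | mul y z _ _ hy hz =>
    have h : g * (y * z) * g⁻¹ = (g * y * g⁻¹) * (g * z * g⁻¹) := by group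
    rw [h]
    exact Subgroup.mul_mem _ hy hz
  | inv y _ hy =>
    have h : g * y⁻¹ * g⁻¹ = (g * y * g⁻¹)⁻¹ := by group
    rw [h]
    exact Subgroup.inv_mem _ hy

/-- **every commutator is a product of three squares**: `a b a⁻¹ b⁻¹ = (ab)² · (b⁻¹a⁻¹b)² · (b⁻¹)² ∈ ⟨squares⟩`.
[cite: Artin1988, Chap. IV Thm. 4.7] -/
theorem commutator_mem_closure_isSquare (a b : G) :
    a * b * a⁻¹ * b⁻¹ ∈ Subgroup.closure {y : G | IsSquare y} := by
  have h : a * b * a⁻¹ * b⁻¹ =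
      ((a * b) * (a * b)) * (((b⁻¹ * a⁻¹ * b) * (b⁻¹ * a⁻¹ * b)) * (b⁻¹ * b⁻¹)) := by group
  rw [h]
  exact Subgroup.mul_mem _ (Subgroup.subset_closure ⟨a * b, rfl⟩)
    (Subgroup.mul_mem _ (Subgroup.subset_closure ⟨b⁻¹ * a⁻¹ * b, rfl⟩) (Subgroup.subset_closure ⟨b⁻¹, rfl⟩))

/-- **two multiplicative scalars with equal squares agree, given representatives.**  Let `S₀ ∋ 1` be a multiplicatively
closed subset of a group, `c, τ : G → K` (a field) multiplicative on `S₀` with `τ ≠ 0` and `c² = τ²` on `S₀`, and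
`R ⊆ S₀` a set on which `c = τ`; if every `p ∈ S₀` is `(∏ qᵢ²) · r` with `qᵢ ∈ S₀`, `r ∈ R`, then `c = τ` on `S₀`
(on squares `c(q²) = c(q)² = τ(q)² = τ(q²)`).  The square-generated case is `R = {1}`.
[cite: Artin1988, Chap. IV Thm. 4.7] -/
theorem eq_of_sq_eq_of_prod_squares_mul_rep {K : Type*} [Field K] (S₀ : Set G) (hS1 : (1 : G) ∈ S₀)
    (hSmul : ∀ p ∈ S₀, ∀ q ∈ S₀, p * q ∈ S₀) (c τ : G → K)
    (hc : ∀ p ∈ S₀, ∀ q ∈ S₀, c (p * q) = c p * c q) (hτ : ∀ p ∈ S₀, ∀ q ∈ S₀, τ (p * q) = τ p * τ q)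
    (hτ0 : ∀ p ∈ S₀, τ p ≠ 0) (hsq : ∀ p ∈ S₀, c p ^ 2 = τ p ^ 2)
    (R : Set G) (hRS : R ⊆ S₀) (hR : ∀ r ∈ R, c r = τ r)
    (hgen : ∀ p ∈ S₀, ∃ (l : List G) (r : G), (∀ q ∈ l, q ∈ S₀) ∧ r ∈ R ∧ p = (l.map fun q => q * q).prod * r) :
    ∀ p ∈ S₀, c p = τ p := by
  -- on squares
  have hsqr : ∀ q ∈ S₀, c (q * q) = τ (q * q) := fun q hq => by
    rw [hc q hq q hq, hτ q hq q hq, ← sq, ← sq, hsq q hq]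
  -- `τ 1 = 1 = c 1`
  have hτ1 : τ 1 = 1 := by
    have h := hτ 1 hS1 1 hS1
    rw [one_mul] at h
    exact (mul_right_eq_self₀.1 h.symm).resolve_right (hτ0 1 hS1)
  have hc1 : c 1 = 1 := by
    have h := hc 1 hS1 1 hS1
    rw [one_mul] at h
    rcases (mul_right_eq_self₀.1 h.symm) with h1 | h0
    · exact h1
    · have h2 := hsq 1 hS1
      rw [h0, hτ1] at h2
      norm_num at h2
  -- products of squares (partial products stay in `S₀`)
  have key : ∀ l : List G, (∀ q ∈ l, q ∈ S₀) →
      (l.map fun q => q * q).prod ∈ S₀ ∧ c (l.map fun q => q * q).prod = τ (l.map fun q => q * q).prod := by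
    intro l
    induction l with
    | nil =>
      intro _
      exact ⟨by simpa using hS1, by simp only [List.map_nil, List.prod_nil, hc1, hτ1]⟩
    | cons q l ih =>
      intro hl
      have hq : q ∈ S₀ := hl q (by simp)
      obtain ⟨hmem, heq⟩ := ih fun q' hq' => hl q' (by simp [hq'])
      refine ⟨?_, ?_⟩
      · simp only [List.map_cons, List.prod_cons]
        exact hSmul _ (hSmul q hq q hq) _ hmem
      · simp only [List.map_cons, List.prod_cons]
        rw [hc _ (hSmul q hq q hq) _ hmem, hτ _ (hSmul q hq q hq) _ hmem, hsqr q hq, heq]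
  intro p hp
  obtain ⟨l, r, hl, hr, rfl⟩ := hgen p hp
  obtain ⟨hmem, heq⟩ := key l hl
  rw [hc _ hmem r (hRS hr), hτ _ hmem r (hRS hr), heq, hR r hr]

end Abstract

/-! ## §2. `GL_n` over a linearly ordered field with square roots: `⟨g²⟩ = GL_n⁺` -/

namespace GeneralLinearGroup

variable {n : Type*} [Fintype n] [DecidableEq n] {𝕜 : Type*} [Field 𝕜]

/-- the single-entry diagonal matrix `diag(1,…,d,…,1)` has determinant `d`. [folklore] -/
private theorem det_diagonal_update_one (i : n) (d : 𝕜) : (diagonal (Function.update 1 i d)).det = d := by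
  rw [det_diagonal, Finset.prod_update_of_mem (Finset.mem_univ i)]
  simp

/-- `diag(1,…,d,…,1)` is invertible for `d ≠ 0`. [folklore] -/
private theorem det_diagonal_update_one_ne_zero (i : n) {d : 𝕜} (hd : d ≠ 0) :
    (diagonal (Function.update (1 : n → 𝕜) i d)).det ≠ 0 := by
  rw [det_diagonal_update_one]; exact hd

/-- `diag(1,…,a,…,1) · diag(1,…,b,…,1) = diag(1,…,ab,…,1)` (same slot). [folklore] -/
private theorem diagonal_update_one_mul (i : n) (a b : 𝕜) :
    diagonal (Function.update (1 : n → 𝕜) i a) * diagonal (Function.update (1 : n → 𝕜) i b) =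
      diagonal (Function.update (1 : n → 𝕜) i (a * b)) := by
  rw [diagonal_mul_diagonal]
  refine congrArg diagonal (funext fun x => ?_)
  by_cases hx : x = i
  · subst hx; simp
  · simp [Function.update_of_ne hx]

/-- the sign flip `ε_i = diag(1,…,-1,…,1)` is an involution. [folklore] -/
private theorem flip_mul_flip (i : n) :
    Matrix.GeneralLinearGroup.mkOfDetNeZero _ (det_diagonal_update_one_ne_zero i (neg_ne_zero.2 (one_ne_zero' 𝕜))) *
      Matrix.GeneralLinearGroup.mkOfDetNeZero _ (det_diagonal_update_one_ne_zero i (neg_ne_zero.2 (one_ne_zero' 𝕜))) = 1 := by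
  apply Units.ext
  change diagonal (Function.update (1 : n → 𝕜) i (-1)) * diagonal (Function.update (1 : n → 𝕜) i (-1)) = 1
  rw [diagonal_update_one_mul, neg_one_mul, neg_neg,
    show Function.update (1 : n → 𝕜) i 1 = 1 from Function.update_eq_self i (1 : n → 𝕜)]
  exact diagonal_one

/-- **two sign flips form a commutator**: `ε_i ε_j = [P_{(ij)}, ε_j] ∈ ⟨g²⟩` for `i ≠ j` (`P_{(ij)}` the permutation
matrix of the transposition, `P ε_j P⁻¹ = ε_i`). [cite: Artin1988, Chap. IV Thm. 4.7] -/
private theorem flip_mul_flip_mem (i j : n) :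
    Matrix.GeneralLinearGroup.mkOfDetNeZero _ (det_diagonal_update_one_ne_zero i (neg_ne_zero.2 (one_ne_zero' 𝕜))) *
      Matrix.GeneralLinearGroup.mkOfDetNeZero _ (det_diagonal_update_one_ne_zero j (neg_ne_zero.2 (one_ne_zero' 𝕜))) ∈
      Subgroup.closure {g : GL n 𝕜 | IsSquare g} := by
  -- the permutation matrix of the transposition `(i j)`, an involution in `GL_n`
  set σ : Equiv.Perm n := Equiv.swap i j with hσ
  have hPP : σ.permMatrix 𝕜 * σ.permMatrix 𝕜 = 1 := by
    rw [← Matrix.permMatrix_mul, hσ, Equiv.swap_mul_self, Matrix.permMatrix_one]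
  have hPdet : (σ.permMatrix 𝕜).det ≠ 0 := fun h => by
    have h1 := congrArg Matrix.det hPP
    rw [det_mul, h, mul_zero, det_one] at h1
    exact zero_ne_one h1
  set P : GL n 𝕜 := Matrix.GeneralLinearGroup.mkOfDetNeZero _ hPdet with hP
  set εi : GL n 𝕜 := Matrix.GeneralLinearGroup.mkOfDetNeZero _
    (det_diagonal_update_one_ne_zero i (neg_ne_zero.2 (one_ne_zero' 𝕜))) with hεi
  set εj : GL n 𝕜 := Matrix.GeneralLinearGroup.mkOfDetNeZero _
    (det_diagonal_update_one_ne_zero j (neg_ne_zero.2 (one_ne_zero' 𝕜))) with hεj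
  have hPinv : P⁻¹ = P := inv_eq_of_mul_eq_one_right (Units.ext hPP)
  have hεjinv : εj⁻¹ = εj := inv_eq_of_mul_eq_one_right (flip_mul_flip j)
  -- `P ε_j P = ε_i`
  have hconj : P * εj * P = εi := by
    apply Units.ext
    change σ.permMatrix 𝕜 * diagonal (Function.update (1 : n → 𝕜) j (-1)) * σ.permMatrix 𝕜 =
      diagonal (Function.update (1 : n → 𝕜) i (-1))
    rw [Matrix.mul_assoc, Equiv.Perm.permMatrix, PEquiv.mul_toMatrix_toPEquiv, PEquiv.toMatrix_toPEquiv_mul,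
      Matrix.submatrix_submatrix, Function.id_comp, Function.comp_id, hσ, Equiv.symm_swap,
      Matrix.submatrix_diagonal_equiv, Function.update_comp_equiv, Pi.one_comp, Equiv.symm_swap,
      Equiv.swap_apply_right]
  have h : εi * εj = P * εj * P⁻¹ * εj⁻¹ := by rw [hPinv, hεjinv, hconj]
  rw [h]
  exact commutator_mem_closure_isSquare P εj

variable [LinearOrder 𝕜] [IsStrictOrderedRing 𝕜]

/-- **a product of squares has positive determinant**: `⟨g²⟩ ≤ GL_n⁺` over any ordered field.
[cite: Artin1988, Chap. IV Thm. 4.7] -/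
theorem closure_isSquare_le_GLPos : Subgroup.closure {g : GL n 𝕜 | IsSquare g} ≤ Matrix.GLPos n 𝕜 := by
  rw [Subgroup.closure_le]
  rintro g ⟨r, rfl⟩
  rw [SetLike.mem_coe, Matrix.mem_glpos, map_mul, Units.val_mul]
  exact mul_self_pos.2 (Units.ne_zero _)

omit [IsStrictOrderedRing 𝕜] in
/-- a positive single-entry diagonal matrix is a square of invertible matrices, hence in `⟨g²⟩`.
[cite: Artin1988, Chap. IV Thm. 4.6] -/
private theorem diagonal_update_one_mem_of_pos (hsq : ∀ x : 𝕜, 0 ≤ x → IsSquare x) (i : n) {d : 𝕜} (hd : 0 < d) :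
    Matrix.GeneralLinearGroup.mkOfDetNeZero _ (det_diagonal_update_one_ne_zero i hd.ne') ∈
      Subgroup.closure {g : GL n 𝕜 | IsSquare g} := by
  obtain ⟨s, hs⟩ := hsq d hd.le
  have hs0 : s ≠ 0 := fun h => hd.ne' (by rw [hs, h, mul_zero])
  refine Subgroup.subset_closure ⟨Matrix.GeneralLinearGroup.mkOfDetNeZero _ (det_diagonal_update_one_ne_zero i hs0), ?_⟩
  apply Units.ext
  change diagonal (Function.update (1 : n → 𝕜) i d) = diagonal (Function.update 1 i s) * diagonal (Function.update 1 i s)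
  rw [diagonal_update_one_mul, ← hs]

/-- a single-entry diagonal `diag(1,…,d,…,1)`, `d ≠ 0`, is `(element of ⟨g²⟩) · ε_{i₀}^{a}`: precisely, it is
`u` or `u · ε_{i₀}` with `u ∈ ⟨g²⟩`. [cite: Artin1988, Chap. IV Thm. 4.6] -/
private theorem diagonal_update_one_mem_or (hsq : ∀ x : 𝕜, 0 ≤ x → IsSquare x) (i₀ i : n) {d : 𝕜} (hd : d ≠ 0) :
    ∃ u ∈ Subgroup.closure {g : GL n 𝕜 | IsSquare g},
      Matrix.GeneralLinearGroup.mkOfDetNeZero _ (det_diagonal_update_one_ne_zero i hd) = u ∨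
      Matrix.GeneralLinearGroup.mkOfDetNeZero _ (det_diagonal_update_one_ne_zero i hd) = u *
        Matrix.GeneralLinearGroup.mkOfDetNeZero _
          (det_diagonal_update_one_ne_zero i₀ (neg_ne_zero.2 (one_ne_zero' 𝕜))) := by
  rcases lt_or_gt_of_ne hd with hneg | hpos
  · -- `e_i(d) = e_i(|d|) ε_i = e_i(|d|) (ε_i ε_{i₀}) ε_{i₀}`
    have hpos' : 0 < -d := neg_pos.2 hneg
    refine ⟨Matrix.GeneralLinearGroup.mkOfDetNeZero _ (det_diagonal_update_one_ne_zero i hpos'.ne') *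
      (Matrix.GeneralLinearGroup.mkOfDetNeZero _ (det_diagonal_update_one_ne_zero i (neg_ne_zero.2 (one_ne_zero' 𝕜))) *
        Matrix.GeneralLinearGroup.mkOfDetNeZero _ (det_diagonal_update_one_ne_zero i₀ (neg_ne_zero.2 (one_ne_zero' 𝕜)))),
      Subgroup.mul_mem _ (diagonal_update_one_mem_of_pos hsq i hpos') (flip_mul_flip_mem i i₀), Or.inr ?_⟩
    rw [mul_assoc, mul_assoc, flip_mul_flip i₀, mul_one]
    apply Units.ext
    change diagonal (Function.update (1 : n → 𝕜) i d) =
      diagonal (Function.update (1 : n → 𝕜) i (-d)) * diagonal (Function.update (1 : n → 𝕜) i (-1))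
    rw [diagonal_update_one_mul, mul_neg_one, neg_neg]
  · exact ⟨_, diagonal_update_one_mem_of_pos hsq i hpos, Or.inl rfl⟩

/-- **`GL_n⁺ ≤ ⟨g²⟩`**: over an ordered field in which every non-negative element is a square, every invertible matrix of
POSITIVE determinant is a product of squares of invertible matrices (Thm. 4.6: transvections `t(c) = t(c/2)²` and positive
diagonal entries are squares; a pair of sign flips is a commutator, hence a product of squares).
[cite: Artin1988, Chap. IV Thm. 4.6] -/
theorem mem_closure_isSquare_of_det_pos (hsq : ∀ x : 𝕜, 0 ≤ x → IsSquare x) (g : GL n 𝕜)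
    (hg : 0 < (g : Matrix n n 𝕜).det) : g ∈ Subgroup.closure {g : GL n 𝕜 | IsSquare g} := by
  rcases isEmpty_or_nonempty n with hn | ⟨⟨i₀⟩⟩
  · have h1 : g = 1 := Subsingleton.elim _ _
    rw [h1]; exact Subgroup.one_mem _
  set S := Subgroup.closure {g : GL n 𝕜 | IsSquare g} with hSdef
  set ε : GL n 𝕜 := Matrix.GeneralLinearGroup.mkOfDetNeZero _
    (det_diagonal_update_one_ne_zero i₀ (neg_ne_zero.2 (one_ne_zero' 𝕜))) with hε
  -- predicate: `N = u` or `N = u ε` for some `u ∈ ⟨g²⟩`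
  let Q : Matrix n n 𝕜 → Prop := fun N => ∃ u ∈ S, N = (u : Matrix n n 𝕜) ∨ N = ((u * ε : GL n 𝕜) : Matrix n n 𝕜)
  have hQmul : ∀ A B : Matrix n n 𝕜, Q A → Q B → Q (A * B) := by
    rintro A B ⟨u, hu, hA⟩ ⟨w, hw, hB⟩
    rcases hA with rfl | rfl <;> rcases hB with rfl | rfl
    · exact ⟨u * w, Subgroup.mul_mem _ hu hw, Or.inl (by rw [Units.val_mul])⟩
    · exact ⟨u * w, Subgroup.mul_mem _ hu hw, Or.inr (by rw [← Units.val_mul, ← mul_assoc])⟩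
    · -- `u ε w = u (ε w ε⁻¹) ε`
      refine ⟨u * (ε * w * ε⁻¹), Subgroup.mul_mem _ hu (conj_mem_closure_isSquare ε hw), Or.inr ?_⟩
      rw [← Units.val_mul]
      congr 1
      group
    · -- `u ε w ε = u (ε w ε⁻¹) (ε ε) = u (ε w ε⁻¹)`
      refine ⟨u * (ε * w * ε⁻¹), Subgroup.mul_mem _ hu (conj_mem_closure_isSquare ε hw), Or.inl ?_⟩
      rw [← Units.val_mul]
      congr 1
      have hεε : ε * ε = 1 := flip_mul_flip i₀
      calc u * ε * (w * ε) = u * (ε * w * ε⁻¹) * (ε * ε) := by group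
        _ = u * (ε * w * ε⁻¹) := by rw [hεε, mul_one]
  have hQ : Q (g : Matrix n n 𝕜) := by
    refine diagonal_transvection_induction_of_det_ne_zero Q (g : Matrix n n 𝕜) hg.ne' (fun D hD => ?_)
      (fun t => ?_) (fun A B _ _ hA hB => hQmul A B hA hB)
    · -- diagonal matrices: one entry at a time
      have hDi : ∀ i, D i ≠ 0 := fun i hi => hD (by
        rw [det_diagonal]; exact Finset.prod_eq_zero (Finset.mem_univ i) hi)
      have hstep : ∀ s : Finset n, Q (diagonal fun i => if i ∈ s then D i else 1) := by
        intro s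
        induction s using Finset.induction_on with
        | empty =>
          refine ⟨1, Subgroup.one_mem _, Or.inl ?_⟩
          simp only [Finset.notMem_empty, if_false, Units.val_one]
          exact diagonal_one
        | insert a s has ih =>
          have hfac : (diagonal fun i => if i ∈ insert a s then D i else 1) =
              diagonal (Function.update (1 : n → 𝕜) a (D a)) * diagonal fun i => if i ∈ s then D i else 1 := by
            rw [diagonal_mul_diagonal]
            refine congrArg diagonal (funext fun x => ?_)
            by_cases hx : x = a
            · subst hx
              simp [has]
            · simp [Finset.mem_insert, hx]
          rw [hfac]
          refine hQmul _ _ ?_ ih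
          obtain ⟨u, hu, h⟩ := diagonal_update_one_mem_or hsq i₀ a (hDi a)
          refine ⟨u, hu, ?_⟩
          rcases h with h | h
          · exact Or.inl (congrArg (fun v : GL n 𝕜 => (v : Matrix n n 𝕜)) h)
          · exact Or.inr (congrArg (fun v : GL n 𝕜 => (v : Matrix n n 𝕜)) h)
      have h := hstep Finset.univ
      simp only [Finset.mem_univ, if_true] at h
      exact h
    · -- a transvection is the square of a transvection
      obtain ⟨i, j, hij, c⟩ := t
      have ht : (transvection i j (c / 2)).det ≠ 0 := by
        rw [det_transvection_of_ne i j hij]; exact one_ne_zero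
      refine ⟨Matrix.GeneralLinearGroup.mkOfDetNeZero _ ht * Matrix.GeneralLinearGroup.mkOfDetNeZero _ ht,
        Subgroup.subset_closure ⟨_, rfl⟩, Or.inl ?_⟩
      rw [Units.val_mul]
      change transvection i j c = transvection i j (c / 2) * transvection i j (c / 2)
      rw [transvection_mul_transvection_same i j hij, add_halves]
  -- conclusion: the `ε`-coset has negative determinant
  obtain ⟨u, hu, h⟩ := hQ
  rcases h with h | h
  · obtain rfl : g = u := Units.ext h
    exact hu
  · exfalso
    obtain rfl : g = u * ε := Units.ext h
    have hdet : ((u * ε : GL n 𝕜) : Matrix n n 𝕜).det = (u : Matrix n n 𝕜).det * (-1) := by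
      rw [Units.val_mul, det_mul]
      exact congrArg _ (det_diagonal_update_one i₀ (-1))
    have hu' : 0 < (u : Matrix n n 𝕜).det := by
      have := closure_isSquare_le_GLPos hu
      rw [Matrix.mem_glpos, Matrix.GeneralLinearGroup.val_det_apply] at this
      exact this
    rw [hdet, mul_neg_one] at hg
    exact absurd hg (not_lt.2 (neg_nonpos.2 hu'.le))

/-- **`⟨g²⟩ = GL_n⁺(𝕜)`** for an ordered field with square roots of non-negative elements (e.g. `ℝ`): the subgroup
generated by the squares is the subgroup `Matrix.GLPos` of matrices of positive determinant.
[cite: Artin1988, Chap. IV Thm. 4.6] -/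
theorem closure_isSquare_eq_GLPos (hsq : ∀ x : 𝕜, 0 ≤ x → IsSquare x) :
    Subgroup.closure {g : GL n 𝕜 | IsSquare g} = Matrix.GLPos n 𝕜 := by
  refine le_antisymm closure_isSquare_le_GLPos fun g hg => ?_
  rw [Matrix.mem_glpos, Matrix.GeneralLinearGroup.val_det_apply] at hg
  exact mem_closure_isSquare_of_det_pos hsq g hg

/-- **index two, any negative-determinant representative**: if `det g < 0` and `det ε < 0` then `g ε⁻¹ ∈ ⟨g²⟩`.
[cite: Artin1988, Chap. IV Thm. 4.7] -/
theorem mul_inv_mem_closure_isSquare_of_det_neg (hsq : ∀ x : 𝕜, 0 ≤ x → IsSquare x) {g ε : GL n 𝕜}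
    (hg : (g : Matrix n n 𝕜).det < 0) (hε : (ε : Matrix n n 𝕜).det < 0) :
    g * ε⁻¹ ∈ Subgroup.closure {g : GL n 𝕜 | IsSquare g} := by
  refine mem_closure_isSquare_of_det_pos hsq _ ?_
  rw [Units.val_mul, det_mul, Matrix.coe_units_inv, det_nonsing_inv, Ring.inverse_eq_inv']
  exact mul_pos_of_neg_of_neg hg (inv_lt_zero.2 hε)

/-- **every `g ∈ GL_n(𝕜)` is `u` or `u ε`** with `u` a product of squares, for any fixed `ε` of negative determinant.
[cite: Artin1988, Chap. IV Thm. 4.7] -/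
theorem exists_mem_closure_isSquare_mul_eq (hsq : ∀ x : 𝕜, 0 ≤ x → IsSquare x) {ε : GL n 𝕜}
    (hε : (ε : Matrix n n 𝕜).det < 0) (g : GL n 𝕜) :
    ∃ u ∈ Subgroup.closure {g : GL n 𝕜 | IsSquare g}, g = u ∨ g = u * ε := by
  rcases lt_trichotomy (g : Matrix n n 𝕜).det 0 with hlt | h0 | hgt
  · exact ⟨g * ε⁻¹, mul_inv_mem_closure_isSquare_of_det_neg hsq hlt hε, Or.inr (by rw [inv_mul_cancel_right])⟩
  · exact absurd h0 (Matrix.GeneralLinearGroup.det_ne_zero g)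
  · exact ⟨g, mem_closure_isSquare_of_det_pos hsq g hgt, Or.inl rfl⟩

/-- **two homomorphisms `GL_n(𝕜) →* A` (`A` commutative) with equal squares which agree at ONE element of negative
determinant are equal** (they agree on squares, hence on `⟨g²⟩ = GL_n⁺`, and `GL_n = GL_n⁺ ∪ GL_n⁺ ε`).
[cite: Artin1988, Chap. IV Thm. 4.7] -/
theorem monoidHom_eq_of_sq_eq_sq_of_apply_eq (hsq : ∀ x : 𝕜, 0 ≤ x → IsSquare x) {A : Type*} [CommGroup A]
    (φ ψ : GL n 𝕜 →* A) (h : ∀ g, φ g ^ 2 = ψ g ^ 2) {ε : GL n 𝕜} (hε : (ε : Matrix n n 𝕜).det < 0)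
    (hφε : φ ε = ψ ε) : φ = ψ := by
  -- `φ/ψ` kills the squares, hence `⟨g²⟩`
  have hker : ∀ u ∈ Subgroup.closure {g : GL n 𝕜 | IsSquare g}, φ u = ψ u := by
    intro u hu
    induction hu using Subgroup.closure_induction with
    | mem y hy =>
      obtain ⟨r, rfl⟩ := hy
      rw [map_mul, map_mul, ← sq, ← sq, h r]
    | one => rw [map_one, map_one]
    | mul y z _ _ hy hz => rw [map_mul, map_mul, hy, hz]
    | inv y _ hy => rw [map_inv, map_inv, hy]
  ext g
  obtain ⟨u, hu, hg⟩ := exists_mem_closure_isSquare_mul_eq hsq hε g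
  rcases hg with rfl | rfl
  · exact hker _ hu
  · rw [map_mul, map_mul, hker u hu, hφε]

end GeneralLinearGroup

/-! ## §3. The real numbers -/

namespace GeneralLinearGroup

variable {n : Type*} [Fintype n] [DecidableEq n]

/-- every non-negative real number is a square. [folklore] -/
private theorem real_isSquare_of_nonneg (x : ℝ) (hx : 0 ≤ x) : IsSquare x :=
  ⟨Real.sqrt x, (Real.mul_self_sqrt hx).symm⟩

/-- **`⟨g²⟩ = GL_n⁺(ℝ)`**: the squares of `GL_n(ℝ)` generate exactly the matrices of positive determinant.
[cite: Artin1988, Chap. IV Thm. 4.6] -/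
theorem closure_isSquare_eq_GLPos_real : Subgroup.closure {g : GL n ℝ | IsSquare g} = Matrix.GLPos n ℝ :=
  closure_isSquare_eq_GLPos real_isSquare_of_nonneg

/-- over `ℝ`: every `g` is `u` or `u ε` with `u` a product of squares, for any fixed `ε` with `det ε < 0`.
[cite: Artin1988, Chap. IV Thm. 4.7] -/
theorem exists_mem_closure_isSquare_mul_eq_real {ε : GL n ℝ} (hε : (ε : Matrix n n ℝ).det < 0) (g : GL n ℝ) :
    ∃ u ∈ Subgroup.closure {g : GL n ℝ | IsSquare g}, g = u ∨ g = u * ε :=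
  exists_mem_closure_isSquare_mul_eq real_isSquare_of_nonneg hε g

/-- over `ℝ`: two homomorphisms `GL_n(ℝ) →* A` (`A` commutative) with equal squares agreeing at one element of negative
determinant are equal. [cite: Artin1988, Chap. IV Thm. 4.7] -/
theorem monoidHom_eq_of_sq_eq_sq_of_apply_eq_real {A : Type*} [CommGroup A] (φ ψ : GL n ℝ →* A)
    (h : ∀ g, φ g ^ 2 = ψ g ^ 2) {ε : GL n ℝ} (hε : (ε : Matrix n n ℝ).det < 0) (hφε : φ ε = ψ ε) : φ = ψ :=
  monoidHom_eq_of_sq_eq_sq_of_apply_eq real_isSquare_of_nonneg φ ψ h hε hφε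

/-- over `ℝ`: an invertible matrix of positive determinant is a product of squares of invertible matrices.
[cite: Artin1988, Chap. IV Thm. 4.6] -/
theorem mem_closure_isSquare_of_det_pos_real (g : GL n ℝ) (hg : 0 < (g : Matrix n n ℝ).det) :
    g ∈ Subgroup.closure {g : GL n ℝ | IsSquare g} :=
  mem_closure_isSquare_of_det_pos real_isSquare_of_nonneg g hg

end GeneralLinearGroup

end Literature.LinearAlgebra.Matrix

/-! ### Build-lane note (ops-buildfix G11b-3 recipe v2, as applied by ops to `GelbartRogawski1991/DoubledUnitaryArchSiegelDiagonalModulusGen`)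
`lean -o` (the hub build lane) runs Lean 4.32's library-suggestion indexers over the statement of every local theorem constant that
is not a denied premise; `isDeniedPremise` skips `[implicit_reducible]` constants before any fold, and the status is inert on
theorems.  ONE file-final, top-level `local` attribute (synchronous scoped reducibility extension, never popped before export, not
exported).  No statement or proof is changed.  (This module had no hub olean > 80 min after its accept — children answered
`remote:stale:…:unbuilt` — while later siblings were built within minutes.) -/
set_option allowUnsafeReducibility true in
attribute [local implicit_reducible]
  Literature.LinearAlgebra.Matrix.conj_mem_closure_isSquare
  Literature.LinearAlgebra.Matrix.commutator_mem_closure_isSquare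
  Literature.LinearAlgebra.Matrix.eq_of_sq_eq_of_prod_squares_mul_rep
  Literature.LinearAlgebra.Matrix.GeneralLinearGroup.det_diagonal_update_one
  Literature.LinearAlgebra.Matrix.GeneralLinearGroup.det_diagonal_update_one_ne_zero
  Literature.LinearAlgebra.Matrix.GeneralLinearGroup.diagonal_update_one_mul
  Literature.LinearAlgebra.Matrix.GeneralLinearGroup.flip_mul_flip
  Literature.LinearAlgebra.Matrix.GeneralLinearGroup.flip_mul_flip_mem
  Literature.LinearAlgebra.Matrix.GeneralLinearGroup.closure_isSquare_le_GLPos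
  Literature.LinearAlgebra.Matrix.GeneralLinearGroup.diagonal_update_one_mem_of_pos
  Literature.LinearAlgebra.Matrix.GeneralLinearGroup.diagonal_update_one_mem_or
  Literature.LinearAlgebra.Matrix.GeneralLinearGroup.mem_closure_isSquare_of_det_pos
  Literature.LinearAlgebra.Matrix.GeneralLinearGroup.closure_isSquare_eq_GLPos
  Literature.LinearAlgebra.Matrix.GeneralLinearGroup.mul_inv_mem_closure_isSquare_of_det_neg
  Literature.LinearAlgebra.Matrix.GeneralLinearGroup.exists_mem_closure_isSquare_mul_eq
  Literature.LinearAlgebra.Matrix.GeneralLinearGroup.monoidHom_eq_of_sq_eq_sq_of_apply_eq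
  Literature.LinearAlgebra.Matrix.GeneralLinearGroup.real_isSquare_of_nonneg
  Literature.LinearAlgebra.Matrix.GeneralLinearGroup.closure_isSquare_eq_GLPos_real
  Literature.LinearAlgebra.Matrix.GeneralLinearGroup.exists_mem_closure_isSquare_mul_eq_real
  Literature.LinearAlgebra.Matrix.GeneralLinearGroup.monoidHom_eq_of_sq_eq_sq_of_apply_eq_real
  Literature.LinearAlgebra.Matrix.GeneralLinearGroup.mem_closure_isSquare_of_det_pos_real
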